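import Literature.Computability.QuantumComplexity.HTCnotUniversalityDensityProofs
import Literature.Computability.QuantumComplexity.GoldenArithmetic
import Literature.Computability.QuantumComplexity.SolovayKitaev.Net
import Mathlib.RingTheory.Polynomial.Dickson
import HarnessLib

/-!
# A density criterion for two-generator subgroups of `SU(2)`, and a golden-ratio test for
# elements of infinite order

Topic `Literature/Computability/QuantumComplexity`. Proof infrastructure for the `PromiseBQP`-
hardness of the Jones polynomial at `k = 5` (Aharonov–Arad 2011, Thm. 3.1; Freedman–Larsen–Wang
2002): the images of the braid generators in the one-qubit and two-qubit sectors of the path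
model must generate DENSE subgroups of `SU(2)`. Aharonov–Arad (§4, following Aharonov–Jones–
Landau and Freedman–Larsen–Wang) argue density through the classification of closed subgroups /
Jones' theorem on the braid group images; here we package an elementary matrix-group route,
abstracting the argument of `HTCnotUniversalityDensityProofs.lean` (density of `⟨H, T⟩`):

* `closure_pair_phases_eq_top` — for `g, h ∈ U(2)`: if `tr(g)² = c · det g` where no `μ` with
  `μ + μ⁻¹ = c - 2` is a root of unity (so the eigenvalue ratio of `g` is of infinite order), and
  `h` neither commutes with `g` nor conjugates it to `det g · g⁻¹`, then `⟨g, h, phases⟩` is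
  dense in `U(2)` (torus from the powers of `g` and Kronecker's theorem, then "two tori generate"
  `unitaryGroup_fin_two_eq_top_of_diagU_mem`);
* `mem_closure_pair_of_det_eq_one` — if moreover `det g = det h = 1`, every `A ∈ SU(2)` lies in
  the closure of `⟨g, h⟩` itself (phases are central and compact; an element of `SU(2)` is the
  square of an element of `SU(2)`, which removes the sign ambiguity);
* `pow_ne_one_of_add_inv_eq_toReal` — **the golden-ratio test**: if `μ + μ⁻¹ = a + bφ` with
  `a, b ∈ ℤ` and the CONJUGATE `a + bψ` (`ψ = 1 - φ`) exceeds `2`, then `μ` is not a root of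
  unity. (If `μ^m = 1` then `D_m(a + bφ) = μ^m + μ^{-m} = 2` for the Dickson/Chebyshev
  polynomials `D_m = Polynomial.dickson 1 1 m ∈ ℤ[X]` (Mathlib); applying the conjugation `φ ↦ ψ`
  of `ℤ[φ]` gives `D_m(a + bψ) = 2`, impossible as `D_m(y + y⁻¹) = y^m + y^{-m} > 2` for real
  `y > 1`.) In the path model at `k = 5` all traces are algebraic INTEGERS, so the
  non-integrality test used for `⟨H, T⟩` is unavailable and this conjugate-size test replaces it.

## References

* D. Aharonov, I. Arad, New J. Phys. 13 (2011) 035019, §4 [AharonovArad2011].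
* P. O. Boykin et al., FOCS 1999 (the `⟨H,T⟩` argument abstracted here) [Boykin1999FOCS].
-/

noncomputable section

namespace Literature.Computability.QuantumComplexity

open Matrix Complex

local notation "U2" => Matrix.unitaryGroup (Fin 2) ℂ

/-! ### The golden-ratio test for infinite order -/

section Dickson

open Polynomial

/-- Ring homomorphisms commute with evaluating the Dickson polynomial `D_n = dickson 1 1 n`
(`D_0 = 2, D_1 = X, D_{n+2} = X D_{n+1} - D_n`, Mathlib `Polynomial.dickson`). [folklore] -/
theorem map_eval_dickson_one_one {R S : Type*} [CommRing R] [CommRing S] (f : R →+* S) (c : R) (n : ℕ) :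
    f ((dickson 1 (1 : R) n).eval c) = (dickson 1 (1 : S) n).eval (f c) := by
  rw [← eval₂_at_apply, ← eval_map, map_dickson, map_one]

/-- `D_n(y + y⁻¹) > 2` for real `y > 1` and `n ≥ 1` (`= yⁿ + y⁻ⁿ`). [folklore] -/
theorem two_lt_eval_dickson_of_one_lt {y : ℝ} (hy : 1 < y) {n : ℕ} (hn : 0 < n) :
    2 < (dickson 1 (1 : ℝ) n).eval (y + y⁻¹) := by
  have hy0 : y ≠ 0 := by positivity
  rw [dickson_one_one_eval_add_inv y y⁻¹ (mul_inv_cancel₀ hy0) n, inv_pow]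
  have hyn : 1 < y ^ n := one_lt_pow₀ hy hn.ne'
  have hpos : 0 < y ^ n := by positivity
  have key : (y ^ n - 1) ^ 2 / y ^ n > 0 := by positivity
  have e : y ^ n + (y ^ n)⁻¹ - 2 = (y ^ n - 1) ^ 2 / y ^ n := by field_simp; ring
  linarith

/-- A real number `> 2` is `y + y⁻¹` for some `y > 1`. [folklore] -/
theorem exists_add_inv_eq_of_two_lt {x : ℝ} (hx : 2 < x) : ∃ y : ℝ, 1 < y ∧ y + y⁻¹ = x := by
  have hd : 0 ≤ x ^ 2 - 4 := by nlinarith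
  refine ⟨(x + Real.sqrt (x ^ 2 - 4)) / 2, ?_, ?_⟩
  · have := Real.sqrt_nonneg (x ^ 2 - 4); linarith
  · have hs := Real.sq_sqrt hd
    have hy0 : (x + Real.sqrt (x ^ 2 - 4)) / 2 ≠ 0 := by
      have := Real.sqrt_nonneg (x ^ 2 - 4); intro h; linarith
    field_simp
    nlinarith [hs, Real.sqrt_nonneg (x ^ 2 - 4)]

/-- **The golden-ratio test.** If `μ + μ⁻¹ = toReal c` for some `c ∈ ℤ[φ]` whose conjugate
`toConj c` exceeds `2`, then `μ` is not a root of unity: `μ^m = 1` would give `D_m(c) = 2` in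
`ℤ[φ]` (Dickson/Chebyshev `D_m(μ + μ⁻¹) = μ^m + μ^{-m}`, injectivity of `ℤ[φ] → ℝ`), hence
`D_m(toConj c) = 2`, while `D_m(y + y⁻¹) = y^m + y^{-m} > 2` for `toConj c = y + y⁻¹`, `y > 1`.
[folklore] -/
theorem pow_ne_one_of_add_inv_eq_toReal {μ : ℂ} {c : ZPhi} (hμ : μ + μ⁻¹ = (ZPhi.toReal c : ℂ))
    (hc : 2 < ZPhi.toConj c) {m : ℕ} (hm : 0 < m) : μ ^ m ≠ 1 := by
  intro hpow
  have hμ0 : μ ≠ 0 := by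
    rintro rfl
    rw [zero_pow hm.ne'] at hpow
    exact zero_ne_one hpow
  -- `D_m(c) = 2` in `ℤ[φ]`, via the injective evaluation `ℤ[φ] → ℝ → ℂ`
  set F : ZPhi →+* ℂ := Complex.ofRealHom.comp ZPhi.toReal with hF
  have hFc : F c = μ + μ⁻¹ := by rw [hμ]; rfl
  have h1 : F ((dickson 1 (1 : ZPhi) m).eval c) = 2 := by
    rw [map_eval_dickson_one_one F c m, hFc, dickson_one_one_eval_add_inv μ μ⁻¹ (mul_inv_cancel₀ hμ0) m, hpow,
      inv_pow, hpow, inv_one]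
    norm_num
  have hFinj : Function.Injective F := Complex.ofReal_injective.comp ZPhi.toReal_injective
  have h2 : (dickson 1 (1 : ZPhi) m).eval c = 2 := hFinj (by rw [h1, map_ofNat])
  -- apply the conjugation `φ ↦ ψ`
  have h3 : (dickson 1 (1 : ℝ) m).eval (ZPhi.toConj c) = 2 := by
    rw [← map_eval_dickson_one_one ZPhi.toConj c m, h2, map_ofNat]
  obtain ⟨y, hy, hyc⟩ := exists_add_inv_eq_of_two_lt hc
  have h4 := two_lt_eval_dickson_of_one_lt hy hm
  rw [hyc, h3] at h4
  exact lt_irrefl _ h4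

/-- The test for conjugates `< -2`, reduced to the previous one through `μ ↦ -μ`. [folklore] -/
theorem pow_ne_one_of_add_inv_eq_toReal_of_lt {μ : ℂ} {c : ZPhi} (hμ : μ + μ⁻¹ = (ZPhi.toReal c : ℂ))
    (hc : ZPhi.toConj c < -2) {m : ℕ} (hm : 0 < m) : μ ^ m ≠ 1 := by
  intro hpow
  have hμ' : (-μ) + (-μ)⁻¹ = (ZPhi.toReal (-c) : ℂ) := by
    rw [map_neg, Complex.ofReal_neg, ← hμ, inv_neg]; ring
  have hc' : 2 < ZPhi.toConj (-c) := by rw [map_neg]; linarith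
  refine pow_ne_one_of_add_inv_eq_toReal hμ' hc' (m := 2 * m) (by omega) ?_
  rw [pow_mul, neg_sq, ← pow_mul, mul_comm, pow_mul, hpow, one_pow]

end Dickson

/-! ### Two generators and the phases: density in `U(2)` -/

/-- The generating set `{g, h} ∪ phases`. [folklore] -/
def pairPhaseGen (g h : U2) : Set U2 :=
  {U | U = g ∨ U = h ∨ ∃ c : ℂ, (U : Matrix (Fin 2) (Fin 2) ℂ) = c • (1 : Matrix (Fin 2) (Fin 2) ℂ)}

/-- **Density criterion (with phases).** Let `g, h ∈ U(2)` with `tr(g)² = c · det g`, where no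
`μ` with `μ + μ⁻¹ = c - 2` is a root of unity, `hg ≠ gh`, and `h g h⁻¹ ≠ det g · g⁻¹`. Then the
subgroup generated by `g`, `h` and the phases is dense in `U(2)`. (The eigenvalue ratio `μ` of `g`
satisfies `μ + μ⁻¹ = tr(g)²/det g - 2`; Kronecker's theorem makes the closure contain the torus
through `g`; `h` is outside its normaliser; two tori generate `U(2)`.) [folklore] -/
theorem closure_pairPhaseGen_eq_top (g h : U2) (c : ℂ)
    (htr : (g : Matrix (Fin 2) (Fin 2) ℂ).trace ^ 2 = c * (g : Matrix (Fin 2) (Fin 2) ℂ).det)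
    (hroot : ∀ μ : ℂ, μ + μ⁻¹ = c - 2 → ∀ m : ℕ, 0 < m → μ ^ m ≠ 1)
    (hcomm : h * g ≠ g * h)
    (hconj : (h : Matrix (Fin 2) (Fin 2) ℂ) * g * star (h : Matrix (Fin 2) (Fin 2) ℂ) ≠
      (g : Matrix (Fin 2) (Fin 2) ℂ).det • star (g : Matrix (Fin 2) (Fin 2) ℂ)) :
    (Subgroup.closure (pairPhaseGen g h)).topologicalClosure = ⊤ := by
  set Γ : Subgroup U2 := Subgroup.closure (pairPhaseGen g h) with hΓ
  set K : Subgroup U2 := Γ.topologicalClosure with hK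
  have hKc : IsClosed (K : Set U2) := Subgroup.isClosed_topologicalClosure Γ
  have hΓK : Γ ≤ K := Subgroup.le_topologicalClosure Γ
  have hgΓ : g ∈ Γ := Subgroup.subset_closure (Or.inl rfl)
  have hhΓ : h ∈ Γ := Subgroup.subset_closure (Or.inr (Or.inl rfl))
  have hcΓ : ∀ (c : ℂ) (hc : ‖c‖ = 1), (⟨c • 1, phase_mem_unitaryGroup hc⟩ : U2) ∈ Γ := fun c hc =>
    Subgroup.subset_closure (Or.inr (Or.inr ⟨c, rfl⟩))
  -- diagonalise `g`: `V⁻¹ g V = diag d`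
  set G : Matrix (Fin 2) (Fin 2) ℂ := (g : Matrix (Fin 2) (Fin 2) ℂ) with hGdef
  have hgmem : G ∈ U2 := g.2
  obtain ⟨V, hV, d, hVd⟩ :=
    Literature.MathematicalPhysics.QuantumLattice.exists_unitaryGroup_diagonal_of_commute G (by
      rw [← Matrix.star_eq_conjTranspose, Unitary.mul_star_self_of_mem hgmem,
        Unitary.star_mul_self_of_mem hgmem])
  have hVV : V * star V = 1 := Unitary.mul_star_self_of_mem hV
  have hSVd : star V * G * V = diagonal d := by
    rw [mul_assoc, hVd, ← mul_assoc, Unitary.star_mul_self_of_mem hV, one_mul]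
  set VU : U2 := ⟨V, hV⟩ with hVU
  set D : U2 := VU⁻¹ * g * VU with hDdef
  have hDcoe : (D : Matrix (Fin 2) (Fin 2) ℂ) = diagonal d := by
    rw [hDdef, Submonoid.coe_mul, Submonoid.coe_mul, Matrix.UnitaryGroup.inv_apply]
    exact hSVd
  have hd : ∀ i, ‖d i‖ = 1 :=
    (Literature.MathematicalPhysics.QuantumLattice.diagonal_mem_unitaryGroup_iff d).1 (hDcoe ▸ D.2)
  have hd0 : d 0 ≠ 0 := fun h0 => by simpa [h0] using hd 0
  have hd1 : d 1 ≠ 0 := fun h0 => by simpa [h0] using hd 1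
  -- trace and determinant of `g` in terms of `d`
  have htr' : d 0 + d 1 = G.trace := by
    have h1 : (diagonal d).trace = (star V * G * V).trace := by rw [hSVd]
    rw [Matrix.trace_mul_cycle, hVV, one_mul, Matrix.diagonal_fin_two, Matrix.trace_fin_two] at h1
    simpa using h1
  have hdet : d 0 * d 1 = G.det := by
    have h1 : (diagonal d).det = (star V * G * V).det := by rw [hSVd]
    rw [det_diagonal, Fin.prod_univ_two, det_mul, det_mul] at h1
    have h2 : (star V).det * V.det = 1 := by
      rw [← det_mul, Unitary.star_mul_self_of_mem hV, det_one]
    rw [h1]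
    linear_combination G.det * h2
  -- the eigenvalue ratio `μ`
  set μ : ℂ := d 0 / d 1 with hμdef
  have hμ : μ + μ⁻¹ = c - 2 := by
    have key : (d 0 + d 1) ^ 2 = c * (d 0 * d 1) := by rw [htr', hdet]; exact htr
    rw [hμdef, inv_div, div_add_div _ _ hd1 hd0, div_eq_iff (mul_ne_zero hd1 hd0)]
    linear_combination key
  have hμnorm : ‖μ‖ = 1 := by rw [hμdef, norm_div, hd 0, hd 1, div_one]
  have hμexp : cexp (arg μ * I) = μ := exp_arg_mul_I_of_norm_eq_one hμnorm
  have hμpow : ∀ m : ℕ, 0 < m → μ ^ m ≠ 1 := hroot μ hμ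
  -- the conjugated closed subgroup `K' = V⁻¹ K V`
  set K' : Subgroup U2 := K.comap (MulAut.conj VU).toMonoidHom with hK'
  have memK' : ∀ U : U2, U ∈ K' ↔ VU * U * VU⁻¹ ∈ K := fun U => by
    rw [hK', Subgroup.mem_comap]
    rfl
  have hK'c : IsClosed (K' : Set U2) := by
    have hcont : Continuous fun U : U2 => VU * U * VU⁻¹ := by fun_prop
    have hset : (K' : Set U2) = (fun U : U2 => VU * U * VU⁻¹) ⁻¹' (K : Set U2) := by
      ext U
      exact memK' U
    rw [hset]
    exact hKc.preimage hcont
  have hDK' : D ∈ K' := by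
    rw [memK', hDdef, (by group : VU * (VU⁻¹ * g * VU) * VU⁻¹ = g)]
    exact hΓK hgΓ
  have hcK' : ∀ (c : ℂ) (hc : ‖c‖ = 1), (⟨c • 1, phase_mem_unitaryGroup hc⟩ : U2) ∈ K' := by
    intro c hc
    rw [memK', conj_phase hc]
    exact hΓK (hcΓ c hc)
  -- `diag(μ, 1) = d₁⁻¹ • diag(d) ∈ K'`
  have hθ₀ : diagU (arg μ) 0 ∈ K' := by
    have hc1 : ‖(d 1)⁻¹‖ = 1 := by rw [norm_inv, hd 1, inv_one]
    have heq : diagU (arg μ) 0 = ⟨(d 1)⁻¹ • 1, phase_mem_unitaryGroup hc1⟩ * D := Subtype.ext (by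
      rw [coe_diagU, Submonoid.coe_mul, hDcoe]
      change diagMatrix (arg μ) 0 = (d 1)⁻¹ • (1 : Matrix (Fin 2) (Fin 2) ℂ) * diagonal d
      unfold diagMatrix
      rw [hμexp, Matrix.smul_mul, Matrix.one_mul, Matrix.diagonal_fin_two, hμdef]
      ext i j
      fin_cases i <;> fin_cases j <;> simp [hd1, div_eq_inv_mul])
    rw [heq]
    exact K'.mul_mem (hcK' _ hc1) hDK'
  -- the closed subgroup `Θ = {θ | diag(e^{iθ}, 1) ∈ K'}` of `ℝ`
  let Θ : AddSubgroup ℝ :=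
    { carrier := {θ | diagU θ 0 ∈ K'}
      zero_mem' := by
        change diagU 0 0 ∈ K'
        rw [diagU_zero]
        exact K'.one_mem
      add_mem' := fun {a b} ha hb => by
        change diagU (a + b) 0 ∈ K'
        have e : diagU (a + b) 0 = diagU a 0 * diagU b 0 := by simpa using diagU_add a 0 b 0
        rw [e]
        exact K'.mul_mem ha hb
      neg_mem' := fun {a} ha => by
        change diagU (-a) 0 ∈ K'
        have e : diagU (-a) 0 = (diagU a 0)⁻¹ := by simpa using diagU_neg a 0
        rw [e]
        exact K'.inv_mem ha }
  have hΘc : IsClosed (Θ : Set ℝ) := hK'c.preimage (continuous_diagU 0)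
  have h2π : (2 * Real.pi) ∈ Θ := by
    change diagU (2 * Real.pi) 0 ∈ K'
    have e : diagU (2 * Real.pi) 0 = 1 := Subtype.ext (by
      rw [coe_diagU]
      change diagMatrix (2 * Real.pi) 0 = 1
      unfold diagMatrix
      push_cast
      rw [Complex.exp_two_pi_mul_I, zero_mul, Complex.exp_zero, Matrix.one_fin_two])
    rw [e]
    exact K'.one_mem
  have hargμ : arg μ ∈ Θ := hθ₀
  have hirr : Irrational (arg μ / (2 * Real.pi)) := by
    rintro ⟨q, hq⟩
    have hargq : arg μ = 2 * Real.pi * q := by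
      have h2π0 : (2 * Real.pi) ≠ 0 := by positivity
      field_simp at hq
      linarith
    have hqd : ((q : ℝ) : ℂ) * (q.den : ℂ) = (q.num : ℂ) := by
      have e : (q : ℝ) * q.den = q.num := by exact_mod_cast Rat.mul_den_eq_num q
      exact_mod_cast e
    have hpow : μ ^ q.den = 1 := by
      calc μ ^ q.den = cexp (arg μ * I) ^ q.den := by rw [hμexp]
        _ = cexp (q.den * (arg μ * I)) := (Complex.exp_nat_mul _ q.den).symm
        _ = cexp (q.num * (2 * Real.pi * I)) := by
            congr 1
            rw [hargq]
            push_cast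
            linear_combination (2 * Real.pi * I : ℂ) * hqd
        _ = 1 := Complex.exp_int_mul_two_pi_mul_I q.num
    exact hμpow q.den q.den_pos hpow
  have hΘd : Dense (Θ : Set ℝ) := by
    have hle : AddSubgroup.closure {arg μ, 2 * Real.pi} ≤ Θ := by
      rw [AddSubgroup.closure_le]
      intro x hx
      rcases hx with rfl | rfl
      · exact hargμ
      · exact h2π
    exact (dense_addSubgroupClosure_pair_iff.2 hirr).mono hle
  have hΘuniv : (Θ : Set ℝ) = Set.univ := by
    rw [← hΘc.closure_eq]
    exact hΘd.closure_eq
  have hdiag0 : ∀ θ : ℝ, diagU θ 0 ∈ K' := fun θ => by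
    have e : θ ∈ (Θ : Set ℝ) := hΘuniv ▸ Set.mem_univ θ
    exact e
  have hdiagK' : ∀ a b : ℝ, diagU a b ∈ K' := by
    intro a b
    have hcb : ‖cexp (b * I)‖ = 1 := Complex.norm_exp_ofReal_mul_I b
    have heq : diagU a b = ⟨cexp (b * I) • 1, phase_mem_unitaryGroup hcb⟩ * diagU (a - b) 0 := Subtype.ext (by
      rw [Submonoid.coe_mul, coe_diagU, coe_diagU]
      change diagMatrix a b = cexp (b * I) • (1 : Matrix (Fin 2) (Fin 2) ℂ) * diagMatrix (a - b) 0
      rw [← diagMatrix_self, ← diagMatrix_add]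
      congr 1 <;> ring)
    rw [heq]
    exact K'.mul_mem (hcK' _ hcb) (hdiag0 _)
  -- `P = V⁻¹ h V ∈ K'` does not normalise the torus
  set PU : U2 := VU⁻¹ * h * VU with hPUdef
  have hPK' : PU ∈ K' := by
    rw [memK', hPUdef, (by group : VU * (VU⁻¹ * h * VU) * VU⁻¹ = h)]
    exact hΓK hhΓ
  have hHconj : h = VU * PU * VU⁻¹ := by rw [hPUdef]; group
  have hgconj : g = VU * D * VU⁻¹ := by rw [hDdef]; group
  clear_value PU D
  have hP10 : (PU : Matrix (Fin 2) (Fin 2) ℂ) 1 0 ≠ 0 := by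
    intro h0
    have h01 : (PU : Matrix (Fin 2) (Fin 2) ℂ) 0 1 = 0 := by
      rw [← norm_eq_zero, unitary_fin_two_norm_01 PU.2, h0, norm_zero]
    have hcommD : PU * D = D * PU := Subtype.ext (by
      rw [Submonoid.coe_mul, Submonoid.coe_mul, hDcoe, Matrix.eta_fin_two (PU : Matrix (Fin 2) (Fin 2) ℂ),
        h0, h01, Matrix.diagonal_fin_two, Matrix.mul_fin_two, Matrix.mul_fin_two]
      simp [mul_comm])
    have hhg : h * g = g * h := by
      rw [hHconj, hgconj]
      calc VU * PU * VU⁻¹ * (VU * D * VU⁻¹) = VU * (PU * D) * VU⁻¹ := by group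
        _ = VU * (D * PU) * VU⁻¹ := by rw [hcommD]
        _ = VU * D * VU⁻¹ * (VU * PU * VU⁻¹) := by group
    exact hcomm hhg
  have hP00 : (PU : Matrix (Fin 2) (Fin 2) ℂ) 0 0 ≠ 0 := by
    intro h0
    have h11 : (PU : Matrix (Fin 2) (Fin 2) ℂ) 1 1 = 0 := by
      rw [← norm_eq_zero, unitary_fin_two_norm_11 PU.2, h0, norm_zero]
    have hc1 : ‖(PU : Matrix (Fin 2) (Fin 2) ℂ) 1 0‖ = 1 := by
      have e := unitary_fin_two_norm_sq PU.2
      rw [h0, norm_zero] at e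
      nlinarith [norm_nonneg ((PU : Matrix (Fin 2) (Fin 2) ℂ) 1 0)]
    have hb1 : ‖(PU : Matrix (Fin 2) (Fin 2) ℂ) 0 1‖ = 1 := by
      rw [unitary_fin_two_norm_01 PU.2, hc1]
    have hdd : ‖d 0 * d 1‖ = 1 := by rw [norm_mul, hd 0, hd 1, mul_one]
    have hconjD : PU * D * PU⁻¹ = ⟨(d 0 * d 1) • 1, phase_mem_unitaryGroup hdd⟩ * D⁻¹ := Subtype.ext (by
      rw [Submonoid.coe_mul, Submonoid.coe_mul, Submonoid.coe_mul, Matrix.UnitaryGroup.inv_apply,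
        Matrix.UnitaryGroup.inv_apply, hDcoe, Matrix.eta_fin_two (PU : Matrix (Fin 2) (Fin 2) ℂ), h0, h11,
        Matrix.diagonal_fin_two, star_fin_two, star_fin_two, Matrix.mul_fin_two, Matrix.mul_fin_two]
      change _ = (d 0 * d 1) • (1 : Matrix (Fin 2) (Fin 2) ℂ) * _
      rw [Matrix.smul_mul, Matrix.one_mul]
      have eb := Literature.MathematicalPhysics.QuantumLattice.mul_conj_of_norm_eq_one hb1
      have ec := Literature.MathematicalPhysics.QuantumLattice.mul_conj_of_norm_eq_one hc1
      have e0 := Literature.MathematicalPhysics.QuantumLattice.mul_conj_of_norm_eq_one (hd 0)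
      have e1 := Literature.MathematicalPhysics.QuantumLattice.mul_conj_of_norm_eq_one (hd 1)
      ext i j
      fin_cases i <;> fin_cases j <;> simp
      · linear_combination (d 1) * eb - (d 1) * e0
      · linear_combination (d 0) * ec - (d 0) * e1)
    have hrel : h * g * h⁻¹ = ⟨(d 0 * d 1) • 1, phase_mem_unitaryGroup hdd⟩ * g⁻¹ := by
      rw [hHconj, hgconj]
      calc VU * PU * VU⁻¹ * (VU * D * VU⁻¹) * (VU * PU * VU⁻¹)⁻¹ = VU * (PU * D * PU⁻¹) * VU⁻¹ := by group
        _ = VU * (⟨(d 0 * d 1) • 1, phase_mem_unitaryGroup hdd⟩ * D⁻¹) * VU⁻¹ := by rw [hconjD]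
        _ = VU * ⟨(d 0 * d 1) • 1, phase_mem_unitaryGroup hdd⟩ * VU⁻¹ * (VU * D * VU⁻¹)⁻¹ := by group
        _ = ⟨(d 0 * d 1) • 1, phase_mem_unitaryGroup hdd⟩ * (VU * D * VU⁻¹)⁻¹ := by rw [conj_phase hdd]
    have e := congrArg (fun U : U2 => (U : Matrix (Fin 2) (Fin 2) ℂ)) hrel
    simp only [Submonoid.coe_mul, Matrix.UnitaryGroup.inv_apply] at e
    change (h : Matrix (Fin 2) (Fin 2) ℂ) * G * star (h : Matrix (Fin 2) (Fin 2) ℂ) =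
      (d 0 * d 1) • (1 : Matrix (Fin 2) (Fin 2) ℂ) * star G at e
    rw [Matrix.smul_mul, Matrix.one_mul, hdet] at e
    exact hconj e
  -- two tori generate: `K' = ⊤`, hence `K = ⊤`
  have hK'top : K' = ⊤ := unitaryGroup_fin_two_eq_top_of_diagU_mem K' hdiagK' hPK' hP00 hP10
  rw [eq_top_iff]
  intro W _
  have hW : VU⁻¹ * W * VU ∈ K' := hK'top ▸ Subgroup.mem_top _
  rw [memK', (by group : VU * (VU⁻¹ * W * VU) * VU⁻¹ = W)] at hW
  exact hW

/-! ### Determinant one: density in `SU(2)` without phases -/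

/-- Elements of `⟨g, h, phases⟩` are phases times elements of `⟨g, h⟩`. [folklore] -/
theorem exists_phase_smul_of_mem_closure_pairPhaseGen (g h : U2) {x : U2}
    (hx : x ∈ Subgroup.closure (pairPhaseGen g h)) :
    ∃ c : ℂ, ‖c‖ = 1 ∧ ∃ w ∈ Subgroup.closure ({g, h} : Set U2),
      (x : Matrix (Fin 2) (Fin 2) ℂ) = c • (w : Matrix (Fin 2) (Fin 2) ℂ) := by
  induction hx using Subgroup.closure_induction with
  | mem x hx =>
    rcases hx with rfl | rfl | ⟨c, hc⟩
    · exact ⟨1, norm_one, x, Subgroup.subset_closure (by simp), by rw [one_smul]⟩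
    · exact ⟨1, norm_one, x, Subgroup.subset_closure (by simp), by rw [one_smul]⟩
    · have hc1 : ‖c‖ = 1 := by
        have e := unitary_fin_two_norm_sq x.2
        have e00 : (c • (1 : Matrix (Fin 2) (Fin 2) ℂ)) 0 0 = c := by simp
        have e10 : (c • (1 : Matrix (Fin 2) (Fin 2) ℂ)) 1 0 = 0 := by simp
        rw [hc, e00, e10, norm_zero] at e
        nlinarith [norm_nonneg c]
      exact ⟨c, hc1, 1, Subgroup.one_mem _, by rw [hc]; rfl⟩
  | one => exact ⟨1, norm_one, 1, Subgroup.one_mem _, by rw [one_smul]⟩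
  | mul x y _ _ ihx ihy =>
    obtain ⟨c, hc, w, hw, hxw⟩ := ihx
    obtain ⟨c', hc', w', hw', hyw⟩ := ihy
    refine ⟨c * c', by rw [norm_mul, hc, hc', mul_one], w * w', Subgroup.mul_mem _ hw hw', ?_⟩
    rw [Submonoid.coe_mul, Submonoid.coe_mul, hxw, hyw, Matrix.smul_mul, Matrix.mul_smul, smul_smul]
  | inv x _ ihx =>
    obtain ⟨c, hc, w, hw, hxw⟩ := ihx
    refine ⟨(starRingEnd ℂ) c, by rw [Complex.norm_conj, hc], w⁻¹, Subgroup.inv_mem _ hw, ?_⟩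
    rw [Matrix.UnitaryGroup.inv_apply, Matrix.UnitaryGroup.inv_apply, hxw, star_smul]
    rfl

/-- The commutator map kills phases: for `x = c • w`, `y = c' • w'`,
`x y x⁻¹ y⁻¹ = w w' w⁻¹ w'⁻¹`. [folklore] -/
theorem commutator_eq_of_phase_smul {x y w w' : U2} {c c' : ℂ} (hc : ‖c‖ = 1) (hc' : ‖c'‖ = 1)
    (hx : (x : Matrix (Fin 2) (Fin 2) ℂ) = c • (w : Matrix (Fin 2) (Fin 2) ℂ))
    (hy : (y : Matrix (Fin 2) (Fin 2) ℂ) = c' • (w' : Matrix (Fin 2) (Fin 2) ℂ)) :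
    x * y * x⁻¹ * y⁻¹ = w * w' * w⁻¹ * w'⁻¹ := by
  apply Subtype.ext
  simp only [Submonoid.coe_mul, Matrix.UnitaryGroup.inv_apply]
  rw [hx, hy, star_smul, star_smul]
  simp only [Matrix.smul_mul, Matrix.mul_smul, smul_smul]
  conv_rhs => rw [← one_smul ℂ ((w : Matrix (Fin 2) (Fin 2) ℂ) * (w' : Matrix (Fin 2) (Fin 2) ℂ) *
    star (w : Matrix (Fin 2) (Fin 2) ℂ) * star (w' : Matrix (Fin 2) (Fin 2) ℂ))]
  congr 1
  have e1 := Literature.MathematicalPhysics.QuantumLattice.mul_conj_of_norm_eq_one hc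
  have e2 := Literature.MathematicalPhysics.QuantumLattice.mul_conj_of_norm_eq_one hc'
  simp only [Complex.star_def]
  linear_combination (c' * (starRingEnd ℂ) c') * e1 + e2

/-- **Commutators of `U(2)` lie in the closure of `⟨g, h⟩`** (under the hypotheses of the
criterion): the commutator map is continuous, kills phases, and `⟨g, h, phases⟩` is dense.
[folklore] -/
theorem commutator_mem_topologicalClosure_closure_pair (g h : U2) (c : ℂ)
    (htr : (g : Matrix (Fin 2) (Fin 2) ℂ).trace ^ 2 = c * (g : Matrix (Fin 2) (Fin 2) ℂ).det)
    (hroot : ∀ μ : ℂ, μ + μ⁻¹ = c - 2 → ∀ m : ℕ, 0 < m → μ ^ m ≠ 1)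
    (hcomm : h * g ≠ g * h)
    (hconj : (h : Matrix (Fin 2) (Fin 2) ℂ) * g * star (h : Matrix (Fin 2) (Fin 2) ℂ) ≠
      (g : Matrix (Fin 2) (Fin 2) ℂ).det • star (g : Matrix (Fin 2) (Fin 2) ℂ))
    (A B : U2) : A * B * A⁻¹ * B⁻¹ ∈ (Subgroup.closure ({g, h} : Set U2)).topologicalClosure := by
  set Γ' : Subgroup U2 := Subgroup.closure (pairPhaseGen g h) with hΓ'
  set M : Subgroup U2 := (Subgroup.closure ({g, h} : Set U2)).topologicalClosure with hM
  have hMc : IsClosed (M : Set U2) := Subgroup.isClosed_topologicalClosure _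
  let κ : U2 × U2 → U2 := fun p => p.1 * p.2 * p.1⁻¹ * p.2⁻¹
  have hκ : Continuous κ := by fun_prop
  have h1 : κ '' ((Γ' : Set U2) ×ˢ (Γ' : Set U2)) ⊆ (M : Set U2) := by
    rintro _ ⟨⟨x, y⟩, ⟨hx, hy⟩, rfl⟩
    obtain ⟨cx, hcx, w, hw, hxw⟩ := exists_phase_smul_of_mem_closure_pairPhaseGen g h hx
    obtain ⟨cy, hcy, w', hw', hyw⟩ := exists_phase_smul_of_mem_closure_pairPhaseGen g h hy
    change x * y * x⁻¹ * y⁻¹ ∈ (M : Set U2)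
    rw [commutator_eq_of_phase_smul hcx hcy hxw hyw]
    exact Subgroup.le_topologicalClosure _
      (Subgroup.mul_mem _ (Subgroup.mul_mem _ (Subgroup.mul_mem _ hw hw') (Subgroup.inv_mem _ hw))
        (Subgroup.inv_mem _ hw'))
  have h2 : closure ((Γ' : Set U2) ×ˢ (Γ' : Set U2)) = Set.univ := by
    rw [closure_prod_eq, ← Subgroup.topologicalClosure_coe, closure_pairPhaseGen_eq_top g h c htr hroot hcomm hconj,
      Subgroup.coe_top, Set.univ_prod_univ]
  have h3 : κ '' closure ((Γ' : Set U2) ×ˢ (Γ' : Set U2)) ⊆ (M : Set U2) :=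
    (image_closure_subset_closure_image hκ).trans (hMc.closure_subset_iff.2 h1)
  exact h3 ⟨(A, B), by rw [h2]; exact Set.mem_univ _, rfl⟩

/-- The signed swap `[[0, 1], [-1, 0]] ∈ U(2)`. [folklore] -/
def swapMatrix : Matrix (Fin 2) (Fin 2) ℂ := !![0, 1; -1, 0]

/-- The signed swap is unitary. [folklore] -/
theorem swapMatrix_mem : swapMatrix ∈ U2 := by
  rw [Matrix.mem_unitaryGroup_iff]
  unfold swapMatrix
  rw [star_fin_two, Matrix.mul_fin_two]
  ext i j
  fin_cases i <;> fin_cases j <;> simp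

/-- **`diag(e^{2iα}, e^{-2iα})` is a commutator**: `[diag(e^{iα}, e^{-iα}), swap]`. [folklore] -/
theorem diagU_two_mul_eq_commutator (α : ℝ) :
    diagU (2 * α) (-(2 * α)) = diagU α (-α) * ⟨swapMatrix, swapMatrix_mem⟩ * (diagU α (-α))⁻¹ *
      (⟨swapMatrix, swapMatrix_mem⟩ : U2)⁻¹ := by
  apply Subtype.ext
  simp only [Submonoid.coe_mul, Matrix.UnitaryGroup.inv_apply, coe_diagU]
  unfold diagMatrix swapMatrix
  rw [star_fin_two, star_fin_two]
  simp only [Matrix.mul_fin_two]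
  ext i j
  fin_cases i <;> fin_cases j <;> simp
  · rw [← Complex.exp_conj, ← Complex.exp_add]; congr 1; simp [Complex.conj_ofReal]; ring
  · rw [← Complex.exp_conj, ← Complex.exp_add]; congr 1; simp [Complex.conj_ofReal]; ring

/-- **Every element of `SU(2)` is a commutator of two elements of `U(2)`** (`A = u D u⁻¹`,
`D = diag(e^{iθ}, e^{-iθ}) = [diag(e^{iθ/2}, e^{-iθ/2}), swap]`). [folklore] -/
theorem exists_eq_commutator_of_det_eq_one (A : U2) (hA : (A : Matrix (Fin 2) (Fin 2) ℂ).det = 1) :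
    ∃ P Q : U2, A = P * Q * P⁻¹ * Q⁻¹ := by
  set x : Matrix.specialUnitaryGroup (Fin 2) ℂ := ⟨A, Matrix.mem_specialUnitaryGroup_iff.2 ⟨A.2, hA⟩⟩ with hx
  obtain ⟨u, D, d, hD, hxu⟩ := Literature.MathematicalPhysics.QuantumLattice.exists_conj_eq_diagonal x
  -- `D = diag(d₀, d₁)` with `|d₀| = 1` and `d₀ d₁ = 1`
  have hDmem : (D : Matrix (Fin 2) (Fin 2) ℂ) ∈ U2 := D.2.1
  have hd : ∀ i, ‖d i‖ = 1 :=
    (Literature.MathematicalPhysics.QuantumLattice.diagonal_mem_unitaryGroup_iff d).1 (hD ▸ hDmem)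
  have hdet : d 0 * d 1 = 1 := by
    have e := (Matrix.mem_specialUnitaryGroup_iff.1 D.2).2
    rw [hD, det_diagonal, Fin.prod_univ_two] at e
    exact e
  have hd0exp : cexp (arg (d 0) * I) = d 0 := exp_arg_mul_I_of_norm_eq_one (hd 0)
  -- the `U(2)` elements
  set uU : U2 := ⟨(u : Matrix (Fin 2) (Fin 2) ℂ), u.2.1⟩ with huU
  set DU : U2 := ⟨(D : Matrix (Fin 2) (Fin 2) ℂ), hDmem⟩ with hDU
  have hDU' : DU = diagU (2 * (arg (d 0) / 2)) (-(2 * (arg (d 0) / 2))) := by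
    apply Subtype.ext
    rw [coe_diagU]
    change (D : Matrix (Fin 2) (Fin 2) ℂ) = diagMatrix _ _
    rw [hD, Matrix.diagonal_fin_two]
    unfold diagMatrix
    have e0 : cexp (((2 * (arg (d 0) / 2) : ℝ) : ℂ) * I) = d 0 := by
      rw [show ((2 * (arg (d 0) / 2) : ℝ) : ℂ) = (arg (d 0) : ℂ) by push_cast; ring]; exact hd0exp
    have e1 : cexp (((-(2 * (arg (d 0) / 2)) : ℝ) : ℂ) * I) = d 1 := by
      rw [show ((-(2 * (arg (d 0) / 2)) : ℝ) : ℂ) * I = -((arg (d 0) : ℂ) * I) by push_cast; ring,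
        Complex.exp_neg, hd0exp]
      exact inv_eq_of_mul_eq_one_right hdet
    rw [e0, e1]
  have hA' : A = uU * DU * uU⁻¹ := by
    apply Subtype.ext
    have e := congrArg (fun y : Matrix.specialUnitaryGroup (Fin 2) ℂ => (y : Matrix (Fin 2) (Fin 2) ℂ)) hxu
    simp only [hx] at e
    rw [Submonoid.coe_mul, Submonoid.coe_mul, Matrix.UnitaryGroup.inv_apply]
    change (A : Matrix (Fin 2) (Fin 2) ℂ) = (u : Matrix (Fin 2) (Fin 2) ℂ) * D * star (u : Matrix (Fin 2) (Fin 2) ℂ)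
    rw [e]
    rfl
  set α : ℝ := arg (d 0) / 2
  refine ⟨uU * diagU α (-α) * uU⁻¹, uU * ⟨swapMatrix, swapMatrix_mem⟩ * uU⁻¹, ?_⟩
  rw [hA', hDU', diagU_two_mul_eq_commutator]
  group

/-- **Density criterion in `SU(2)`.** Under the hypotheses of `closure_pairPhaseGen_eq_top`,
every `A ∈ U(2)` with `det A = 1` lies in the closure of the subgroup generated by `g` and `h`
alone. [folklore] -/
theorem mem_topologicalClosure_closure_pair_of_det_eq_one (g h : U2) (c : ℂ)
    (htr : (g : Matrix (Fin 2) (Fin 2) ℂ).trace ^ 2 = c * (g : Matrix (Fin 2) (Fin 2) ℂ).det)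
    (hroot : ∀ μ : ℂ, μ + μ⁻¹ = c - 2 → ∀ m : ℕ, 0 < m → μ ^ m ≠ 1)
    (hcomm : h * g ≠ g * h)
    (hconj : (h : Matrix (Fin 2) (Fin 2) ℂ) * g * star (h : Matrix (Fin 2) (Fin 2) ℂ) ≠
      (g : Matrix (Fin 2) (Fin 2) ℂ).det • star (g : Matrix (Fin 2) (Fin 2) ℂ))
    (A : U2) (hA : (A : Matrix (Fin 2) (Fin 2) ℂ).det = 1) :
    A ∈ (Subgroup.closure ({g, h} : Set U2)).topologicalClosure := by
  obtain ⟨P, Q, rfl⟩ := exists_eq_commutator_of_det_eq_one A hA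
  exact commutator_mem_topologicalClosure_closure_pair g h c htr hroot hcomm hconj P Q

section Approx

open scoped Matrix.Norms.L2Operator

/-- **Approximation form**: under the same hypotheses, every `A ∈ SU(2)` is approximated to any
precision, in operator norm, by (the product of) a word in `g, h, g⁻¹, h⁻¹`. [folklore] -/
theorem exists_word_near_of_det_eq_one (g h : U2) (c : ℂ)
    (htr : (g : Matrix (Fin 2) (Fin 2) ℂ).trace ^ 2 = c * (g : Matrix (Fin 2) (Fin 2) ℂ).det)
    (hroot : ∀ μ : ℂ, μ + μ⁻¹ = c - 2 → ∀ m : ℕ, 0 < m → μ ^ m ≠ 1)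
    (hcomm : h * g ≠ g * h)
    (hconj : (h : Matrix (Fin 2) (Fin 2) ℂ) * g * star (h : Matrix (Fin 2) (Fin 2) ℂ) ≠
      (g : Matrix (Fin 2) (Fin 2) ℂ).det • star (g : Matrix (Fin 2) (Fin 2) ℂ))
    (A : U2) (hA : (A : Matrix (Fin 2) (Fin 2) ℂ).det = 1) {ε : ℝ} (hε : 0 < ε) :
    ∃ w : List U2, (∀ x ∈ w, x ∈ ({g, h, g⁻¹, h⁻¹} : Set U2)) ∧
      ‖((w.prod : U2) : Matrix (Fin 2) (Fin 2) ℂ) - (A : Matrix (Fin 2) (Fin 2) ℂ)‖ < ε := by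
  have hmem := mem_topologicalClosure_closure_pair_of_det_eq_one g h c htr hroot hcomm hconj A hA
  have hmem' : A ∈ closure ((Subgroup.closure ({g, h} : Set U2) : Set U2)) := by
    rw [← Subgroup.topologicalClosure_coe]; exact hmem
  -- the open `ε`-ball around `A` meets the generated subgroup
  have hO : IsOpen {V : U2 | ‖(A : Matrix (Fin 2) (Fin 2) ℂ) - (V : Matrix (Fin 2) (Fin 2) ℂ)‖ < ε} := by
    have e : {V : U2 | ‖(A : Matrix (Fin 2) (Fin 2) ℂ) - (V : Matrix (Fin 2) (Fin 2) ℂ)‖ < ε} =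
        Subtype.val ⁻¹' Metric.ball (A : Matrix (Fin 2) (Fin 2) ℂ) ε := by
      ext V
      simp only [Set.mem_setOf_eq, Set.mem_preimage, Metric.mem_ball, dist_eq_norm, norm_sub_rev]
    rw [e]
    exact Metric.isOpen_ball.preimage continuous_subtype_val
  have hAO : A ∈ {V : U2 | ‖(A : Matrix (Fin 2) (Fin 2) ℂ) - (V : Matrix (Fin 2) (Fin 2) ℂ)‖ < ε} := by
    simp [hε]
  obtain ⟨B, hBO, hBmem⟩ := mem_closure_iff.1 hmem' _ hO hAO
  -- `B` is a product of generators and inverses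
  have hG : ∀ x ∈ ({g, h, g⁻¹, h⁻¹} : Set U2), x⁻¹ ∈ ({g, h, g⁻¹, h⁻¹} : Set U2) := by
    intro x hx
    simp only [Set.mem_insert_iff, Set.mem_singleton_iff] at hx ⊢
    rcases hx with rfl | rfl | rfl | rfl <;> simp
  have hle : Subgroup.closure ({g, h} : Set U2) ≤ Subgroup.closure ({g, h, g⁻¹, h⁻¹} : Set U2) :=
    Subgroup.closure_mono (by intro x hx; simp only [Set.mem_insert_iff, Set.mem_singleton_iff] at hx ⊢; tauto)
  obtain ⟨w, hw, hprod⟩ := SolovayKitaev.exists_list_prod_eq_of_mem_closure hG (hle hBmem)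
  refine ⟨w, hw, ?_⟩
  rw [hprod, norm_sub_rev]
  exact hBO

end Approx

end Literature.Computability.QuantumComplexity

end
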